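import Summits.QuantumFields.BalabanUV.Beta.RemainderExplicitHistoryDiagonalRateUniform

/-!
# RemainderExplicitHistoryDiagonalRatePowerTailTwo — ROAD P3, ORDER-0 PROFILE FAMILY: THE RATE IN THE CUTOFF FOR THE FIRST-MOMENT POWER
# TAILS `R(N) − R(k) ≤ T₀∕(k+1)^q`, `1 < q < 2` — the third file's two shapes hold with `A₁ = 8∕(2−q)` and `A₂ = T₀(4q∕(q−1) + 4)`, so
# `astar g m − invSq g m n ≤ Λ√m·T₀∕(n+2)^q` above the threshold and with one more factor `b∕(b−Wγ)` below it; with the eighth file's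
# minorant side (valid for every `q ≥ 0`) the rate `√m∕n^q` is two-sided and pointwise for the whole range `0 < q < 2`, `q ≠ 1`
# (third file of station S-d4p3-g50-1; generation 49's census OPEN (i))

Cell `pub-balaban`, β-function sub-cell, BINDER row D4 «RemainderConst leaves for Bałaban's split» (`HOME/BINDER-OWNERS.md`; owner
lineage `b2b-balaban-beta-an4`; this file by co-owner #3 lineage `b2b-balaban-beta-d4-p3`, road P3 «the reduction road», generation 50,
station S-d4p3-g50-1, third file; imports the station's second file `RemainderExplicitHistoryDiagonalRateUniform`), β-FLOW TEAM duty (1);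
FREEZE (0) honoured (def-free module in road P3's own `RemainderExplicit*` series; no leaf, no interface, no Literature file).  SOURCE OF THE
SHAPES ONLY: [Balaban1987RG1] (0.20) p. 256, (0.31) and Thm 2 p. 259, §5 p. 298.  Pure real analysis about ONE explicit toy family (ours).

HONEST FRAMING (page 1 of everything the β sub-cell writes).  *"Discharging BetaPertH makes Bałaban's UV stability UNCONDITIONAL — a real
constructive-QFT result; it is NOT the continuum limit and NOT the Clay problem."*  THIS FILE DISCHARGES NOTHING OF THE KIND.  Generation
49's seventh ∕ eighth files priced the rate in the cutoff for every power tail `O(k^{−q})` with `0 < q < 1` (Bernoulli bounds with exponent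
`q`); its census left OPEN (i) the first-moment range `1 ≤ q < 2`.  For `1 < q < 2` the same two shapes of the third file hold — (T1) because
`Σ_{k<K}(2k+1)∕(k+2)^q ≤ 2Σ_{k<K}(k+1)^{1−q} ≤ 2K^{2−q}∕(2−q)` (the seventh file's `sum_head_le` with the exponent `q − 1 ∈ ]0,1[`) and
`(K+1)^q ≤ 4K^q`; (T2) because the young half of the convolution is now a CONVERGENT `q`-series (`≤ 1 + 1∕(q−1)`, the seventh file's
`sum_tail_le` with exponent `q − 1`) and the old half a `(1+q)`-tail (`≤ 1`) — so the third file's rate, the station's uniform threshold and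
pointwise lower side all apply verbatim.  `q = 1` (a logarithm in (T1)) and `q ≥ 2` ((T1) fails: the `min(a,K)²`-moment is then `O(K^{2−q})`
no more, the ultraviolet half decays faster than the majorant `√σ·τ`) are not treated.  Nothing of Bałaban's (1.22) is asserted or
constructed; row D4 class UNCHANGED (critical-path width 0; instance 0∕1; D4 DISCHARGE NO DATE); NOT B12 Thm 2, NOT BetaPertH, NOT continuum,
NOT Clay.  HONEST DEPENDENCY: continuum YM on T⁴ ⇐ BetaPertH ∧ nine spine estimates (0/9 proved); BetaPertH ⇐ (D1) ∧ (D4) ∧ CAP+tail;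
G-an2-4 gates asym, D1 and NE2/3/4.  ABSOLUTE RULE: nothing is cited as a fact.

WHAT IS PROVED ([folklore]; 0 sorry; 0 `def`; Mathlib + the station only).
* §1 `sum_rpow_pred_le` (`Σ_{k<K} 1∕(k+1)^{q−1} ≤ K^{2−q}∕(2−q)`, `1 < q < 2`), `sum_rpow_le_of_one_lt` (`Σ_{i<N} 1∕(i+1)^q ≤ 1 + 1∕(q−1)`,
  `1 < q ≤ 2`), `sum_tail_le_one` (`Σ_{t<N} 1∕((t+2)^q(t+2)) ≤ 1`, `1 ≤ q`).
* §2 **`powerTailTwo_T1`** (`A₁ = 8∕(2−q)`), **`powerTailTwo_T2`** (`A₂ = T₀(4q∕(q−1) + 4)`).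
* §3 **`powerTailTwo_rate`** (`T₀(4q∕(q−1)+4) ≤ b√b√m`, `m ≤ n+1` ⇒ `astar g m − invSq g m n ≤ Λ₈√m·T₀∕(n+2)^q`,
  `Λ₈ = 4∕√b + 64√2κ∕((2−q)(1−Wγ∕b)√b)`), **`powerTailTwo_rate_uniform`** (below the threshold, one more factor `1∕(1 − Wγ∕b)`); the lower
  side is the eighth file's `powerTail_rate_lower` ∕ the second file's `powerTail_rate_lower_pointwise` (every `q ≥ 0`).
All letters NOT-IN-PRINT; `BetaFlowAsPrinted S` records a Markov β_n only ⇒ no junction of the as-printed interface changes.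
-/

noncomputable section

open Finset Filter Topology

namespace Summit.QuantumFields.BalabanUV.Beta.RemainderExplicitHistoryDiagonalRatePowerTailTwo

open Literature.MathematicalPhysics.QuantumFieldTheory.Balaban1983to89
open Literature.MathematicalPhysics.QuantumFieldTheory.Balaban1983to89.FlowStep
open Literature.MathematicalPhysics.QuantumFieldTheory.Balaban1983to89.T4CouplingMatching
open Literature.MathematicalPhysics.QuantumFieldTheory.Balaban1983to89.T4ContinuumCoupling
open Summit.QuantumFields.BalabanUV.Beta.RemainderExplicitHistoryDiagonalRate
open Summit.QuantumFields.BalabanUV.Beta.RemainderExplicitHistoryDiagonalRatePowerShapes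
open Summit.QuantumFields.BalabanUV.Beta.RemainderExplicitHistoryDiagonalRatePowerTail (powerTail_antitone)
open Summit.QuantumFields.BalabanUV.Beta.RemainderExplicitHistoryDiagonalRateUniform

variable {β : HBeta} {b γ W : ℝ} {ρ : ℕ → ℝ}

/-! ## §1 Three elementary sums for exponents `1 < q < 2` -/

/-- `Σ_{k<K} 1∕(k+1)^{q−1} ≤ K^{2−q}∕(2−q)` for `1 < q < 2` (the seventh file's `sum_head_le` with the exponent `q − 1 ∈ ]0,1[`). [folklore] -/
theorem sum_rpow_pred_le {q : ℝ} (hq1 : 1 < q) (hq2 : q < 2) (K : ℕ) :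
    ∑ k ∈ range K, 1 / ((k : ℝ) + 1) ^ (q - 1) ≤ (K : ℝ) ^ (2 - q) / (2 - q) := by
  have h := sum_head_le (q := q - 1) (by linarith) (by linarith) K
  rw [show (1 : ℝ) - (q - 1) = 2 - q by ring] at h
  exact h

/-- `Σ_{i<N} 1∕(i+1)^q ≤ 1 + 1∕(q−1)` for `1 < q ≤ 2` (the term `i = 0` plus the seventh file's `sum_tail_le` with the exponent `q − 1`:
`1∕((t+2)^{q−1}(t+2)) = 1∕(t+2)^q`). [folklore] -/
theorem sum_rpow_le_of_one_lt {q : ℝ} (hq1 : 1 < q) (hq2 : q ≤ 2) (N : ℕ) :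
    ∑ i ∈ range N, 1 / ((i : ℝ) + 1) ^ q ≤ 1 + 1 / (q - 1) := by
  have hq1' : 0 < q - 1 := by linarith
  cases N with
  | zero => rw [Finset.sum_range_zero]; positivity
  | succ N =>
    rw [Finset.sum_range_succ']
    have h0 : 1 / ((((0 : ℕ) : ℝ)) + 1) ^ q = 1 := by simp
    have ht := sum_tail_le (q := q - 1) hq1' (by linarith) N
    have e : ∀ i : ℕ, 1 / ((((i + 1 : ℕ) : ℝ)) + 1) ^ q = 1 / ((((i : ℝ) + 2) ^ (q - 1)) * ((i : ℝ) + 2)) := by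
      intro i
      have hx : (0 : ℝ) < (i : ℝ) + 2 := by positivity
      have e1 : ((((i + 1 : ℕ) : ℝ)) + 1) = (i : ℝ) + 2 := by push_cast; ring
      rw [e1, Real.rpow_sub_one hx.ne', div_mul_cancel₀ _ hx.ne']
    rw [h0, Finset.sum_congr rfl fun i _ => e i]
    linarith

/-- `Σ_{t<N} 1∕((t+2)^q(t+2)) ≤ 1` for `q ≥ 1` (`(t+2)^q ≥ t+2`, then the seventh file's `sum_tail_le` at exponent `1`). [folklore] -/
theorem sum_tail_le_one {q : ℝ} (hq1 : 1 ≤ q) (N : ℕ) :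
    ∑ t ∈ range N, 1 / ((((t : ℝ) + 2) ^ q) * ((t : ℝ) + 2)) ≤ 1 := by
  have h1 := sum_tail_le (q := 1) one_pos le_rfl N
  rw [div_one] at h1
  refine le_trans (Finset.sum_le_sum fun t _ => ?_) h1
  have hx : (1 : ℝ) ≤ (t : ℝ) + 2 := by have : (0 : ℝ) ≤ t := Nat.cast_nonneg t; linarith
  have hx0 : (0 : ℝ) < (t : ℝ) + 2 := by linarith
  have hmono : ((t : ℝ) + 2) ^ (1 : ℝ) ≤ ((t : ℝ) + 2) ^ q := Real.rpow_le_rpow_of_exponent_le hx hq1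
  exact one_div_le_one_div_of_le (mul_pos (Real.rpow_pos_of_pos hx0 1) hx0) (mul_le_mul_of_nonneg_right hmono hx0.le)

/-! ## §2 The two shapes of the third file for `τ(k) = T₀∕(k+1)^q`, `1 < q < 2` -/

/-- SHAPE (T1) WITH `A₁ = 8∕(2−q)`: if `R(N) − R(k) ≤ T₀∕(k+1)^q` (`k ≤ N`, `T₀ ≥ 0`, `1 < q < 2`), then for `K ≥ 1`:
`Σ_{a<N} ρ(a)min(a,K)² ≤ (8∕(2−q))·K²·(T₀∕(K+1)^q)` — Abel (`sum_minSq_le_tails`), `(2k+1)∕(k+2)^q ≤ 2∕(k+1)^{q−1}`, `sum_rpow_pred_le`, and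
`(K+1)^q ≤ 4K^q`. [folklore] -/
theorem powerTailTwo_T1 {ρ : ℕ → ℝ} {T₀ q : ℝ} (hq1 : 1 < q) (hq2 : q < 2) (hT₀ : 0 ≤ T₀)
    (hτ : ∀ k N, k ≤ N → ∑ a ∈ range N, ρ a - ∑ a ∈ range k, ρ a ≤ T₀ / ((k : ℝ) + 1) ^ q)
    (K N : ℕ) (hK : 1 ≤ K) :
    ∑ a ∈ range N, ρ a * (min (a : ℝ) K) ^ 2 ≤ 8 / (2 - q) * (K : ℝ) ^ 2 * (T₀ / ((K : ℝ) + 1) ^ q) := by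
  have h2q : 0 < 2 - q := by linarith
  have hKr : (1 : ℝ) ≤ K := by exact_mod_cast hK
  have hK0 : (0 : ℝ) < K := by linarith
  have hK1 : (0 : ℝ) < (K : ℝ) + 1 := by linarith
  have hKq0 : 0 < (K : ℝ) ^ q := Real.rpow_pos_of_pos hK0 q
  have hK1q : 0 < ((K : ℝ) + 1) ^ q := Real.rpow_pos_of_pos hK1 q
  have h1 := sum_minSq_le_tails (τ := fun k => T₀ / ((k : ℝ) + 1) ^ q) (fun k => by positivity) hτ K N
  refine h1.trans ?_
  -- each term: `(2k+1)·T₀∕(k+2)^q ≤ 2T₀∕(k+1)^{q−1}`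
  have hterm : ∀ k ∈ range K, (2 * (k : ℝ) + 1) * (T₀ / ((((k + 1 : ℕ) : ℝ)) + 1) ^ q)
      ≤ 2 * T₀ * (1 / ((k : ℝ) + 1) ^ (q - 1)) := by
    intro k _
    have hx : (0 : ℝ) < (k : ℝ) + 2 := by positivity
    have hx1 : (0 : ℝ) < (k : ℝ) + 1 := by positivity
    have e : (((k + 1 : ℕ) : ℝ)) + 1 = (k : ℝ) + 2 := by push_cast; ring
    rw [e]
    have hA : (2 * (k : ℝ) + 1) * (T₀ / ((k : ℝ) + 2) ^ q) ≤ 2 * T₀ * (((k : ℝ) + 2) / ((k : ℝ) + 2) ^ q) := by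
      rw [show 2 * T₀ * (((k : ℝ) + 2) / ((k : ℝ) + 2) ^ q) = (2 * (k : ℝ) + 4) * (T₀ / ((k : ℝ) + 2) ^ q) by ring]
      exact mul_le_mul_of_nonneg_right (by linarith) (by positivity)
    have hB : ((k : ℝ) + 2) / ((k : ℝ) + 2) ^ q ≤ 1 / ((k : ℝ) + 1) ^ (q - 1) := by
      rw [← rpow_one_sub_eq hx]
      have hmono : ((k : ℝ) + 2) ^ (1 - q) ≤ ((k : ℝ) + 1) ^ (1 - q) :=
        Real.rpow_le_rpow_of_nonpos hx1 (by linarith) (by linarith)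
      have e2 : ((k : ℝ) + 1) ^ (1 - q) = 1 / ((k : ℝ) + 1) ^ (q - 1) := by
        rw [show (1 : ℝ) - q = -(q - 1) by ring, Real.rpow_neg hx1.le, one_div]
      rw [← e2]; exact hmono
    exact hA.trans (mul_le_mul_of_nonneg_left hB (by positivity))
  have hsum := sum_rpow_pred_le hq1 hq2 K
  -- `(K+1)^q ≤ 4K^q`
  have h4 : ((K : ℝ) + 1) ^ q ≤ 4 * (K : ℝ) ^ q := by
    have h2K : (K : ℝ) + 1 ≤ 2 * K := by linarith
    have h1' : ((K : ℝ) + 1) ^ q ≤ (2 * (K : ℝ)) ^ q := Real.rpow_le_rpow hK1.le h2K (by linarith)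
    rw [Real.mul_rpow (by norm_num) hK0.le] at h1'
    have h2q' : (2 : ℝ) ^ q ≤ (2 : ℝ) ^ (2 : ℝ) := Real.rpow_le_rpow_of_exponent_le (by norm_num) hq2.le
    rw [Real.rpow_two] at h2q'
    nlinarith [hKq0]
  have hKq : (K : ℝ) ^ (2 - q) = (K : ℝ) ^ 2 / (K : ℝ) ^ q := by
    rw [Real.rpow_sub hK0, Real.rpow_two]
  have h2 : 1 / (K : ℝ) ^ q ≤ 4 / ((K : ℝ) + 1) ^ q := by
    rw [div_le_div_iff₀ hKq0 hK1q]; linarith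
  have hc0 : 0 ≤ 2 * T₀ * (K : ℝ) ^ 2 / (2 - q) := div_nonneg (by positivity) h2q.le
  calc ∑ k ∈ range K, (2 * (k : ℝ) + 1) * (T₀ / ((((k + 1 : ℕ) : ℝ)) + 1) ^ q)
      ≤ ∑ k ∈ range K, 2 * T₀ * (1 / ((k : ℝ) + 1) ^ (q - 1)) := sum_le_sum hterm
    _ = 2 * T₀ * ∑ k ∈ range K, 1 / ((k : ℝ) + 1) ^ (q - 1) := by rw [Finset.mul_sum]
    _ ≤ 2 * T₀ * ((K : ℝ) ^ (2 - q) / (2 - q)) := mul_le_mul_of_nonneg_left hsum (by positivity)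
    _ = 2 * T₀ * (K : ℝ) ^ 2 / (2 - q) * (1 / (K : ℝ) ^ q) := by rw [hKq]; field_simp
    _ ≤ 2 * T₀ * (K : ℝ) ^ 2 / (2 - q) * (4 / ((K : ℝ) + 1) ^ q) := mul_le_mul_of_nonneg_left h2 hc0
    _ = 8 / (2 - q) * (K : ℝ) ^ 2 * (T₀ / ((K : ℝ) + 1) ^ q) := by field_simp; ring

/-- SHAPE (T2) WITH `A₂ = T₀(4q∕(q−1) + 4)` for `τ(k) = T₀∕(k+1)^q`, `1 < q < 2`:
`Σ_{i<j₀} τ(i+1)τ(j₀−i)∕(j₀+1−i) ≤ T₀(4q∕(q−1) + 4)·τ(j₀+1)` (any real `T₀`) — split at `j₀∕2`: young `i` have `j₀+1−i ≥ (j₀+2)∕2` and a convergent `q`-series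
(`sum_rpow_le_of_one_lt`), old `i` have `i+2 ≥ (j₀+2)∕2` and a `(1+q)`-tail (`sum_tail_le_one`); `2^q ≤ 4`. [folklore] -/
theorem powerTailTwo_T2 {T₀ q : ℝ} (hq1 : 1 < q) (hq2 : q < 2) (j₀ : ℕ) :
    ∑ i ∈ range j₀, (T₀ / ((((i + 1 : ℕ) : ℝ)) + 1) ^ q) * (T₀ / ((((j₀ - i : ℕ) : ℝ)) + 1) ^ q)
        / ((j₀ + 1 - i : ℕ) : ℝ)
      ≤ T₀ * (4 * q / (q - 1) + 4) * (T₀ / ((((j₀ + 1 : ℕ) : ℝ)) + 1) ^ q) := by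
  set h : ℕ := j₀ / 2 with hh
  have hq0 : 0 < q := by linarith
  have hq1' : 0 < q - 1 := by linarith
  set w : ℝ := (j₀ : ℝ) + 2 with hw
  have hw0 : 0 < w := by rw [hw]; positivity
  have hw2 : (2 : ℝ) ≤ w := by rw [hw]; have : (0 : ℝ) ≤ j₀ := Nat.cast_nonneg _; linarith
  have hwq : 0 < w ^ q := Real.rpow_pos_of_pos hw0 q
  have h2q : (2 : ℝ) ^ q ≤ 4 := by
    have := Real.rpow_le_rpow_of_exponent_le (x := 2) (by norm_num) hq2.le
    rwa [Real.rpow_two, show (2:ℝ) ^ 2 = 4 by norm_num] at this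
  have h2q0 : 0 < (2 : ℝ) ^ q := Real.rpow_pos_of_pos (by norm_num) q
  have ej : (((j₀ + 1 : ℕ) : ℝ)) + 1 = w := by rw [hw]; push_cast; ring
  rw [ej]
  -- the two majorants
  set cA : ℝ := T₀ ^ 2 * (8 / (w ^ q * w)) with hcA
  set cB : ℝ := T₀ ^ 2 * (4 / w ^ q) with hcB
  have hcA0 : 0 ≤ cA := by positivity
  have hcB0 : 0 ≤ cB := by positivity
  set fA : ℕ → ℝ := fun i => if i ≤ h then cA * (1 / ((i : ℝ) + 1) ^ q) else 0 with hfA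
  set fB : ℕ → ℝ := fun i => cB * (1 / ((((j₀ + 1 - i : ℕ) : ℝ) ^ q) * ((j₀ + 1 - i : ℕ) : ℝ))) with hfB
  -- termwise
  have hterm : ∀ i ∈ range j₀, (T₀ / ((((i + 1 : ℕ) : ℝ)) + 1) ^ q) * (T₀ / ((((j₀ - i : ℕ) : ℝ)) + 1) ^ q)
        / ((j₀ + 1 - i : ℕ) : ℝ) ≤ fA i + fB i := by
    intro i hi
    have hi' := Finset.mem_range.mp hi
    have ei : (((i + 1 : ℕ) : ℝ)) + 1 = (i : ℝ) + 2 := by push_cast; ring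
    have ev : (((j₀ - i : ℕ) : ℝ)) + 1 = ((j₀ + 1 - i : ℕ) : ℝ) := by
      rw [show j₀ + 1 - i = (j₀ - i) + 1 by omega]; push_cast; ring
    rw [ei, ev]
    set v : ℝ := ((j₀ + 1 - i : ℕ) : ℝ) with hv
    have hv0 : (0 : ℝ) < v := by rw [hv]; exact_mod_cast (by omega : 0 < j₀ + 1 - i)
    have hvq : 0 < v ^ q := Real.rpow_pos_of_pos hv0 q
    have hx : (0 : ℝ) < (i : ℝ) + 2 := by positivity
    have hxq : 0 < ((i : ℝ) + 2) ^ q := Real.rpow_pos_of_pos hx q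
    have hx1 : (0 : ℝ) < (i : ℝ) + 1 := by positivity
    have hx1q : 0 < ((i : ℝ) + 1) ^ q := Real.rpow_pos_of_pos hx1 q
    have eterm : (T₀ / ((i : ℝ) + 2) ^ q) * (T₀ / v ^ q) / v = T₀ ^ 2 * (1 / ((i : ℝ) + 2) ^ q) * (1 / (v ^ q * v)) := by
      field_simp
    rw [eterm]
    have hfA0 : 0 ≤ fA i := by simp only [hfA]; split_ifs <;> positivity
    have hfB0 : 0 ≤ fB i := by simp only [hfB]; positivity
    by_cases hih : i ≤ h
    · -- young: `v ≥ w∕2`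
      have hvw : w / 2 ≤ v := by
        rw [hw, hv]
        have : (j₀ : ℝ) + 2 ≤ 2 * ((j₀ + 1 - i : ℕ) : ℝ) := by exact_mod_cast (by omega : j₀ + 2 ≤ 2 * (j₀ + 1 - i))
        linarith
      have hw2' : 0 < w / 2 := by positivity
      have hvv : (w / 2) ^ q * (w / 2) ≤ v ^ q * v :=
        mul_le_mul (Real.rpow_le_rpow hw2'.le hvw hq0.le) hvw hw2'.le hvq.le
      have hA1 : 1 / (v ^ q * v) ≤ 1 / ((w / 2) ^ q * (w / 2)) :=
        one_div_le_one_div_of_le (mul_pos (Real.rpow_pos_of_pos hw2' q) hw2') hvv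
      have hA2 : 1 / ((w / 2) ^ q * (w / 2)) ≤ 8 / (w ^ q * w) := by
        rw [Real.div_rpow hw0.le (by norm_num : (0:ℝ) ≤ 2), div_le_div_iff₀ (by positivity) (by positivity)]
        -- `w^q·w ≤ 8·(w^q∕2^q·(w∕2))` iff `2^q ≤ 4`
        have : w ^ q * w * 2 ^ q ≤ w ^ q * w * 4 := mul_le_mul_of_nonneg_left h2q (by positivity)
        field_simp
        nlinarith [this]
      have hA3 : 1 / ((i : ℝ) + 2) ^ q ≤ 1 / ((i : ℝ) + 1) ^ q :=
        one_div_le_one_div_of_le hx1q (Real.rpow_le_rpow hx1.le (by linarith) hq0.le)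
      calc T₀ ^ 2 * (1 / ((i : ℝ) + 2) ^ q) * (1 / (v ^ q * v))
          ≤ T₀ ^ 2 * (1 / ((i : ℝ) + 1) ^ q) * (8 / (w ^ q * w)) :=
            mul_le_mul (mul_le_mul_of_nonneg_left hA3 (by positivity)) (hA1.trans hA2) (by positivity) (by positivity)
        _ = fA i := by simp only [hfA, if_pos hih, hcA]; ring
        _ ≤ fA i + fB i := by linarith
    · -- old: `i + 2 ≥ w∕2`
      rw [not_le] at hih
      have hiw : w / 2 ≤ (i : ℝ) + 2 := by
        rw [hw]
        have : (j₀ : ℝ) < 2 * ((i : ℝ) + 1) := by exact_mod_cast (by omega : j₀ < 2 * (i + 1))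
        linarith
      have hw2' : 0 < w / 2 := by positivity
      have hB1 : 1 / ((i : ℝ) + 2) ^ q ≤ 1 / (w / 2) ^ q :=
        one_div_le_one_div_of_le (Real.rpow_pos_of_pos hw2' q) (Real.rpow_le_rpow hw2'.le hiw hq0.le)
      have hB2 : 1 / (w / 2) ^ q ≤ 4 / w ^ q := by
        rw [Real.div_rpow hw0.le (by norm_num : (0:ℝ) ≤ 2), one_div_div]
        exact div_le_div_of_nonneg_right h2q hwq.le
      calc T₀ ^ 2 * (1 / ((i : ℝ) + 2) ^ q) * (1 / (v ^ q * v))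
          ≤ T₀ ^ 2 * (4 / w ^ q) * (1 / (v ^ q * v)) :=
            mul_le_mul_of_nonneg_right (mul_le_mul_of_nonneg_left (hB1.trans hB2) (by positivity)) (by positivity)
        _ = fB i := by simp only [hfB, hcB, hv]
        _ ≤ fA i + fB i := by linarith
  -- the young half against a convergent `q`-series
  have hA : ∑ i ∈ range j₀, fA i ≤ cA * (1 + 1 / (q - 1)) := by
    have hsub : ∑ i ∈ range j₀, fA i ≤ ∑ i ∈ range (h + 1), cA * (1 / ((i : ℝ) + 1) ^ q) := by
      calc ∑ i ∈ range j₀, fA i = ∑ i ∈ (range j₀).filter (fun i => i ≤ h), cA * (1 / ((i : ℝ) + 1) ^ q) := by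
            rw [Finset.sum_filter]
        _ ≤ ∑ i ∈ range (h + 1), cA * (1 / ((i : ℝ) + 1) ^ q) := by
            refine Finset.sum_le_sum_of_subset_of_nonneg ?_ fun i _ _ => by positivity
            intro i hi
            have := (Finset.mem_filter.mp hi).2
            exact Finset.mem_range.mpr (by omega)
    have hhead := sum_rpow_le_of_one_lt hq1 hq2.le (h + 1)
    calc ∑ i ∈ range j₀, fA i ≤ ∑ i ∈ range (h + 1), cA * (1 / ((i : ℝ) + 1) ^ q) := hsub
      _ = cA * ∑ i ∈ range (h + 1), 1 / ((i : ℝ) + 1) ^ q := by rw [Finset.mul_sum]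
      _ ≤ cA * (1 + 1 / (q - 1)) := mul_le_mul_of_nonneg_left hhead hcA0
  -- the old half against the `(1+q)`-tail, reflected
  have hB : ∑ i ∈ range j₀, fB i ≤ cB * 1 := by
    have hrefl : ∑ i ∈ range j₀, 1 / ((((j₀ + 1 - i : ℕ) : ℝ) ^ q) * ((j₀ + 1 - i : ℕ) : ℝ))
        = ∑ t ∈ range j₀, 1 / ((((t : ℝ) + 2) ^ q) * ((t : ℝ) + 2)) := by
      rw [← Finset.sum_range_reflect (fun t : ℕ => 1 / ((((t : ℝ) + 2) ^ q) * ((t : ℝ) + 2))) j₀]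
      refine Finset.sum_congr rfl fun i hi => ?_
      have hi' := Finset.mem_range.mp hi
      have e : ((j₀ + 1 - i : ℕ) : ℝ) = ((j₀ - 1 - i : ℕ) : ℝ) + 2 := by
        rw [show j₀ + 1 - i = (j₀ - 1 - i) + 2 by omega]; push_cast; ring
      rw [e]
    calc ∑ i ∈ range j₀, fB i = cB * ∑ i ∈ range j₀, 1 / ((((j₀ + 1 - i : ℕ) : ℝ) ^ q) * ((j₀ + 1 - i : ℕ) : ℝ)) := by
          rw [Finset.mul_sum]
      _ ≤ cB * 1 := by rw [hrefl]; exact mul_le_mul_of_nonneg_left (sum_tail_le_one hq1.le j₀) hcB0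
  have hsum2 : ∑ i ∈ range j₀, (fA i + fB i) ≤ cA * (1 + 1 / (q - 1)) + cB * 1 := by
    rw [Finset.sum_add_distrib]; exact add_le_add hA hB
  refine ((Finset.sum_le_sum hterm).trans hsum2).trans ?_
  -- algebra: `cA·(1 + 1∕(q−1)) = 8T₀²q∕((q−1)·w^q·w) ≤ 4qT₀²∕((q−1)w^q)` (`w ≥ 2`) and `cB = 4T₀²∕w^q`
  have e1 : cA * (1 + 1 / (q - 1)) = (8 * T₀ ^ 2 * q / ((q - 1) * w ^ q)) * (1 / w) := by
    simp only [hcA]; field_simp; ring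
  have e2 : cB * 1 = 4 * T₀ ^ 2 / w ^ q := by simp only [hcB]; ring
  have h3 : (8 * T₀ ^ 2 * q / ((q - 1) * w ^ q)) * (1 / w) ≤ (8 * T₀ ^ 2 * q / ((q - 1) * w ^ q)) * (1 / 2) :=
    mul_le_mul_of_nonneg_left (one_div_le_one_div_of_le (by norm_num) hw2) (by positivity)
  rw [e1, e2]
  calc 8 * T₀ ^ 2 * q / ((q - 1) * w ^ q) * (1 / w) + 4 * T₀ ^ 2 / w ^ q
      ≤ 8 * T₀ ^ 2 * q / ((q - 1) * w ^ q) * (1 / 2) + 4 * T₀ ^ 2 / w ^ q := by linarith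
    _ = T₀ * (4 * q / (q - 1) + 4) * (T₀ / w ^ q) := by field_simp; ring

/-! ## §3 The rate for the first-moment power tails -/

/-- **ROAD P3 — THE RATE IN THE CUTOFF FOR EVERY POWER TAIL `1 < q < 2`.**  A pinned family of runs of the order-0 profile family in ]0,γ]
(`b > 0`, `γ > 0`, `ρ ≥ 0`, `Σ_{a<N} ρ_a ≤ W`, `Wγ < b`) whose profile has the tail majorant `R(N) − R(k) ≤ T₀∕(k+1)^q` with `1 < q < 2`,
`T₀ ≥ 0`.  THEN for every infrared distance `m` with `T₀(4q∕(q−1) + 4) ≤ b√b·√m` and every cutoff `n ≥ m − 1`: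
`0 ≤ astar g m − invSq g m n ≤ Λ₈·√m·T₀∕(n+2)^q`, `Λ₈ = 4∕√b + 8√2κ(8∕(2−q))∕((1−Wγ∕b)√b)`, `κ = (b+Wγ)∕b` — the third file's
`astar_sub_invSq_le_rate` with `powerTailTwo_T1` ∕ `powerTailTwo_T2`.  With the eighth file's `powerTail_rate_lower` (minorant `T₁∕(k+1)^q`,
any `q ≥ 0`): the rate `√m∕n^q`, two-sided, for the whole first-moment range. [cite: Balaban1987RG1, (0.20) p.256, (0.31) and Thm 2 p.259] -/
theorem powerTailTwo_rate {T₀ q : ℝ}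
    (hβ : ∀ (k : ℕ) (p : Fin (k + 1) → ℝ),
      β k p = b + ∑ i : Fin (k + 1), ρ (k - i) * min (p (Fin.last k)) (|p (Fin.last k) - p i|))
    (hb : 0 < b) (hγ : 0 < γ) (hρ0 : ∀ a, 0 ≤ ρ a) (hρW : ∀ n, ∑ a ∈ range n, ρ a ≤ W) (hsmall : W * γ < b)
    (hq1 : 1 < q) (hq2 : q < 2) (hT₀ : 0 ≤ T₀)
    (hτ : ∀ k N : ℕ, k ≤ N → ∑ a ∈ range N, ρ a - ∑ a ∈ range k, ρ a ≤ T₀ / ((k : ℝ) + 1) ^ q)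
    {g : ℕ → ℕ → ℝ} {gIR : ℝ} (hrun : ∀ K, RGEqH K β (g K)) (hbox : ∀ K i, i ≤ K → 0 < g K i ∧ g K i ≤ γ)
    (hpin : ∀ K, g K K = gIR) {m n : ℕ} (hm : T₀ * (4 * q / (q - 1) + 4) ≤ b * Real.sqrt b * Real.sqrt (m : ℝ))
    (hmn : m ≤ n + 1) :
    0 ≤ astar g m - invSq g m n ∧ astar g m - invSq g m n
      ≤ (4 / Real.sqrt b + 8 * Real.sqrt 2 * ((b + W * γ) / b) * (8 / (2 - q)) / ((1 - W * γ / b) * Real.sqrt b))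
        * Real.sqrt (m : ℝ) * (T₀ / ((((n + 1 : ℕ) : ℝ)) + 1) ^ q) := by
  have h2q : 0 < 2 - q := by linarith
  exact astar_sub_invSq_le_rate (τ := fun k => T₀ / ((k : ℝ) + 1) ^ q) (A₁ := 8 / (2 - q)) (A₂ := T₀ * (4 * q / (q - 1) + 4))
    hβ hb hγ hρ0 hρW hsmall (fun k => by positivity) (fun _ _ hkl => powerTail_antitone hT₀ (by linarith) hkl) hτ
    (div_nonneg (by norm_num) h2q.le)
    (fun K N hK => powerTailTwo_T1 hq1 hq2 hT₀ hτ K N hK) (fun j₀ => powerTailTwo_T2 hq1 hq2 j₀) hrun hbox hpin hm hmn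

/-- **THE SAME BELOW THE THRESHOLD DISTANCE, ONE CONSTANT** (the station's second file): threshold `T₀(4q∕(q−1)+4) ≤ b√b·√σ₀`; for every
`m ≤ σ₀` and `n` with `2σ₀ ≤ n+m+1`: `astar g m − invSq g m n ≤ Λ₈√σ₀·T₀∕(n+m+2−σ₀)^q ∕ (1 − Wγ∕b)`.
[cite: Balaban1987RG1, (0.20) p.256, (0.31) and Thm 2 p.259] -/
theorem powerTailTwo_rate_uniform {T₀ q : ℝ}
    (hβ : ∀ (k : ℕ) (p : Fin (k + 1) → ℝ),
      β k p = b + ∑ i : Fin (k + 1), ρ (k - i) * min (p (Fin.last k)) (|p (Fin.last k) - p i|))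
    (hb : 0 < b) (hγ : 0 < γ) (hρ0 : ∀ a, 0 ≤ ρ a) (hρW : ∀ n, ∑ a ∈ range n, ρ a ≤ W) (hsmall : W * γ < b)
    (hq1 : 1 < q) (hq2 : q < 2) (hT₀ : 0 ≤ T₀)
    (hτ : ∀ k N : ℕ, k ≤ N → ∑ a ∈ range N, ρ a - ∑ a ∈ range k, ρ a ≤ T₀ / ((k : ℝ) + 1) ^ q)
    {g : ℕ → ℕ → ℝ} {gIR : ℝ} (hrun : ∀ K, RGEqH K β (g K)) (hbox : ∀ K i, i ≤ K → 0 < g K i ∧ g K i ≤ γ)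
    (hpin : ∀ K, g K K = gIR) {σ₀ m n : ℕ} (hσ₀ : T₀ * (4 * q / (q - 1) + 4) ≤ b * Real.sqrt b * Real.sqrt (σ₀ : ℝ))
    (hm : m ≤ σ₀) (hn : 2 * σ₀ ≤ n + m + 1) :
    0 ≤ astar g m - invSq g m n ∧ astar g m - invSq g m n
      ≤ (4 / Real.sqrt b + 8 * Real.sqrt 2 * ((b + W * γ) / b) * (8 / (2 - q)) / ((1 - W * γ / b) * Real.sqrt b))
          * Real.sqrt (σ₀ : ℝ) * (T₀ / ((((n + m + 1 - σ₀ : ℕ) : ℝ)) + 1) ^ q) / (1 - W * γ / b) := by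
  have h2q : 0 < 2 - q := by linarith
  exact astar_sub_invSq_le_rate_uniform (τ := fun k => T₀ / ((k : ℝ) + 1) ^ q) (A₁ := 8 / (2 - q))
    (A₂ := T₀ * (4 * q / (q - 1) + 4))
    hβ hb hγ hρ0 hρW hsmall (fun k => by positivity) (fun _ _ hkl => powerTail_antitone hT₀ (by linarith) hkl) hτ
    (div_nonneg (by norm_num) h2q.le)
    (fun K N hK => powerTailTwo_T1 hq1 hq2 hT₀ hτ K N hK) (fun j₀ => powerTailTwo_T2 hq1 hq2 j₀) hrun hbox hpin hσ₀ hm hn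

end Summit.QuantumFields.BalabanUV.Beta.RemainderExplicitHistoryDiagonalRatePowerTailTwo

end
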